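import Literature.NumberTheory.LFunctions.YoshidaWindowGramColumnData
import HarnessLib

/-!
# C∞ rung `R1E` (even sector) — DATA `PVNT` part 1/1

Route context: Fourier–Galerkin / Schur-complement certificates of Weil positivity on a window ("format C", C∞ door `weilPositivityOn_of_cinf_pipeline`); supporting stmt-RiemannHypothesis-0098; seat rh-explicit-weil-2 (`cinfemit.py`/`emit_lean2.py`, HOME/rh-explicit-weil-2/gen17/EMITTER-PHASE2.md). Data / bookkeeping only; standard axioms; no RH claim.
-/

set_option autoImplicit false
-- `Summit.RiemannHypothesis.RiemannHypothesis.…` is the layout-mandated namespace (summit = problem name).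
set_option linter.dupNamespace false

namespace Summit.RiemannHypothesis.RiemannHypothesis.Theorems.WeilFormatC

open Literature.NumberTheory.LFunctions

namespace CinfR1E

/-- Packed rows part 1/1 of table `PVNT` (word width 355, 4 words). -/
def PVNT_P : List ℕ := [
  0x7fffffffffced5c5d020b4e984d886f7b6b0de920ff4b63c4ceed98d0730dd2d269de9633d1eccb873a5018e70000000000000296971da69a774774ded6a4843d04a208ed717d051513bf1cab5d28df59726c507b6d46d98fdffffffffffffffffdd1e98e5d9aaf98495f9cddb9a2b1013a123dda31b3b990bd48986d8eee7b9bf7f6ff1b9400000000000000000001f3065abfc226b08251b2395ec992fcb1d4df8507786ad65fe59e190ff164748904ed,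
  0x80000006e0989a4cad0773c4c871cd7375989df92260489e392a08bcbf5127d50579652cfec69ed17b897f976ffffffffffa350c81b9fa5d65a660d23b8bf4337bef80783ae184d788c1a08262b4163e03855c4a4ba705720e00000000000004e104963daa2a440f39f34f477bf1d79c499c0dc5b227e5e39d196510e626bf67acd4c76335bffffffffffffffffba3d33f0b250bf0944cbbadf308f225be73da3b65bfe3e3ac540df396e0ab5e81b46191a,
  0x7ffefab44fcd50c152760ebe7811ff30f8b9a26b3ea3336b245dd591f46a94d15aa7aebc245138458d268307b0000000dc16d135bfc9d3b2dececdcda39c6c5054647eb6f1eecdf5895a11f8e005bc0ab51a4cc213a733a199ffffffffff46a190373187459a2c4a25dcd552929612653023bde05469bf4d302e5a1fccbac907abb949405f40000000000000a5a5c24862422ff22cc9eb4bd51869ac6e09a28dda3c9559bd75badb2e70a0aa0c08866678a,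
  0xa6c6f3a6b6671cb9dc3257be8c837af0aaf31dccb8938921e1948b3395280ab896a5c895827cff06a96218d7afffdf5689f9aa1834db9b65966f727bdbaa4d9d5040a28e3c3ddeaccbc1d71cea2a21d8d4ea16232a14eba6ae0000001b82626934bfe174aa046f0d3a6d4a9524bdbc422753a309d74711dfa107e13e6445ded9533b02f9273fffffffffe76ae3ab4296fb0ec02550f16a1e4021361b497f23e82c2bbf055b54cc27dfaba618b31dd0f2186]

end CinfR1E

end Summit.RiemannHypothesis.RiemannHypothesis.Theorems.WeilFormatC
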